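import Mathlib
import Summits.NavierStokesRegularity.FluidComputer.EmergenceBootstrap

/-!
# Emergence from a mild solution: the R-β chain assembled modulo three named analytic inputs (instab g13, cell `ns-blowup`, 2026-08-26)

HONEST FRAMING (human ruling D-0035): nothing here is a claim about Navier–Stokes blow-up.
WHAT THIS IS NOT: not NS evidence. This file closes the bookkeeping of `instab/INSTAB-BRIDGE.md`
§10 (R-β «rope emergence with an amplitude floor and a clock») / §13 l.126: it states, for an
ABSTRACT trajectory in a normed space, exactly what the «generation / mild-solution layer»
(l.126 (b)(i), memo-grade, Lean price L) has to deliver for the kernel pieces already in the tree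
(`EmergenceBootstrap.duhamel_term_le`, `floor_of_bootstrap`, `half_prediction_le`) to compose into
the R-β sentence. No semigroup theory is used or assumed: the evolution family `T`, the bilinear
loss `B` and the weaker norm `p` enter only through three inequalities / identities, which are the
three NAMED DELIVERABLES of the analytic layer:

* (M) MILD FORMULA about the linear prediction: `u t − ℓ t = ∫₀ᵗ T (t − s) (B (u s) (u s)) ds` on
  `[0, T₀]` (Bochner integral), with `‖ℓ t‖ = ε e^{λt}` (for a real eigenpair `Av⋆ = λv⋆`,
  `‖v⋆‖ = 1`: `ℓ t = (ε e^{λt}) • v⋆ = e^{tA}(ε v⋆)`), and `u` continuous on `[0, T₀]`;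
* (T) SMOOTHING BOUND of the linear evolution from the weak norm `p` (the `H¹_κ₀` level) to the
  strong norm (the `g_κ₀` level): `‖T τ x‖ ≤ S τ^{−1/2} e^{ωτ} p x` for `τ > 0` — the certified
  constant `S` of the two-level Lyapunov certificate 3-L′
  (`LyapunovSkewCutSemigroup.norm_le_of_two_level`);
* (B) BILINEAR LOSS: `p (B x y) ≤ c ‖x‖ ‖y‖` — the displayed algebra constant `c = c_alg(κ₀)`
  (`ConvectiveProductLawLattice` / `ConvectiveProductLawTorus`).

Given (M)(T)(B) and the gap `2λ > ω`:

* `norm_sub_le_of_mild` — the DEVIATION bound: if `‖u s‖ ≤ Q ε e^{λs}` on `[0, t]` then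
  `‖u t − ℓ t‖ ≤ C (Q ε e^{λt})²` with `C = S·c·√(π/(2λ − ω))` (norm of the Bochner integral ≤
  integral of the pointwise bound off the endpoint `s = t`, then `duhamel_term_le`);
* `abs_norm_sub_le_of_mild` — hence `|‖u t‖ − ε e^{λt}| ≤ C (Q ε e^{λt})²`, the hypothesis `hdev`
  of `EmergenceBootstrap.floor_of_bootstrap`;
* `floor_of_mild` — R-β ASSEMBLED: if moreover `Q ≥ 1`, `ε > 0` and the window condition
  `C Q² ε e^{λt} < Q − 1` holds on `[0, T₀]`, then on all of `[0, T₀]`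
  `ε e^{λt} (1 − C Q² ε e^{λt}) ≤ ‖u t‖ ≤ ε e^{λt} + C (Q ε e^{λt})²`;
* `half_prediction_of_mild` — with `Q = 3/2`: `‖u t‖ ≥ ε e^{λt}/2` wherever
  `ε e^{λt} ≤ χ⋆ = 2/(9C)` — the amplitude floor `χ⋆/2` is reached no later than the linear clock.

So the CERTIFIED EMERGENCE STATEMENT of l.126 (c) is a kernel theorem CONDITIONAL on exactly
(M)(T)(B) with the certified numbers `(λ, S, c, ω)`; nothing here is about singularity formation.

Mathlib + `EmergenceBootstrap`; no new definitions.
-/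

noncomputable section

namespace Summit.NavierStokesRegularity.FluidComputer.EmergenceMildDuhamel

open Set MeasureTheory intervalIntegral
open Summit.NavierStokesRegularity.FluidComputer.EmergenceBootstrap

variable {E : Type*} [NormedAddCommGroup E] [NormedSpace ℝ E]

/-- The Duhamel majorant `s ↦ S (t − s)^{−1/2} e^{ω(t−s)} · c (Q ε e^{λs})²` is integrable on
`(0, t]` (the `−1/2` power is integrable at the endpoint). -/
theorem intervalIntegrable_majorant (S c Q ε lam ω t : ℝ) :
    IntervalIntegrable (fun s => S * (t - s) ^ (-(1 / 2 : ℝ)) * Real.exp (ω * (t - s)) *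
      (c * (Q * ε * Real.exp (lam * s)) ^ 2)) volume 0 t := by
  have hr : IntervalIntegrable (fun x : ℝ => x ^ (-(1 / 2 : ℝ))) volume t 0 :=
    intervalIntegral.intervalIntegrable_rpow' (by norm_num)
  have hr' : IntervalIntegrable (fun s : ℝ => (t - s) ^ (-(1 / 2 : ℝ))) volume 0 t := by
    have := hr.comp_sub_left t
    simp only [sub_self, sub_zero] at this
    exact this
  have hcont : ContinuousOn (fun s : ℝ => S * Real.exp (ω * (t - s)) *
      (c * (Q * ε * Real.exp (lam * s)) ^ 2)) (uIcc 0 t) :=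
    (by fun_prop : Continuous fun s : ℝ => S * Real.exp (ω * (t - s)) *
      (c * (Q * ε * Real.exp (lam * s)) ^ 2)).continuousOn
  have h := hr'.mul_continuousOn hcont
  have hfun : (fun s => S * (t - s) ^ (-(1 / 2 : ℝ)) * Real.exp (ω * (t - s)) *
      (c * (Q * ε * Real.exp (lam * s)) ^ 2)) = fun s => (t - s) ^ (-(1 / 2 : ℝ)) *
      (S * Real.exp (ω * (t - s)) * (c * (Q * ε * Real.exp (lam * s)) ^ 2)) := by
    funext s; ring
  rw [hfun]
  exact h

/-- **Deviation bound from the mild formula (the Duhamel step of R-β).** Let `T : ℝ → E → E`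
satisfy the smoothing bound (T) `‖T τ x‖ ≤ S τ^{−1/2} e^{ωτ} p x` for `τ > 0` (`S ≥ 0`), let
`B` satisfy the bilinear loss (B) `p (B x y) ≤ c ‖x‖ ‖y‖` (`c ≥ 0`), let `2λ > ω`, `t ≥ 0`, and
suppose the mild formula (M) `u t − ℓ t = ∫₀ᵗ T (t − s) (B (u s) (u s)) ds` together with the
a-priori bound `‖u s‖ ≤ Q ε e^{λs}` on `[0, t]`. Then
`‖u t − ℓ t‖ ≤ S·c·√(π/(2λ − ω)) · (Q ε e^{λt})²`. -/
theorem norm_sub_le_of_mild {p : E → ℝ} {T : ℝ → E → E} {B : E → E → E} {u : ℝ → E} {ℓt : E}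
    {S c Q ε lam ω t : ℝ} (hS : 0 ≤ S) (hc : 0 ≤ c) (hgap : ω < 2 * lam) (ht : 0 ≤ t)
    (hT : ∀ τ : ℝ, 0 < τ → ∀ x : E, ‖T τ x‖ ≤ S * τ ^ (-(1 / 2 : ℝ)) * Real.exp (ω * τ) * p x)
    (hB : ∀ x y : E, p (B x y) ≤ c * ‖x‖ * ‖y‖)
    (hmild : u t - ℓt = ∫ s in (0:ℝ)..t, T (t - s) (B (u s) (u s)))
    (hap : ∀ s ∈ Icc 0 t, ‖u s‖ ≤ Q * ε * Real.exp (lam * s)) :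
    ‖u t - ℓt‖ ≤ S * c * Real.sqrt (Real.pi / (2 * lam - ω)) * (Q * ε * Real.exp (lam * t)) ^ 2 := by
  set g : ℝ → ℝ := fun s => S * (t - s) ^ (-(1 / 2 : ℝ)) * Real.exp (ω * (t - s)) *
    (c * (Q * ε * Real.exp (lam * s)) ^ 2) with hg
  -- the majorant is integrable on (0, t] and dominates the integrand off the endpoint `s = t`
  have hgi : IntegrableOn g (Ioc 0 t) :=
    (intervalIntegrable_iff_integrableOn_Ioc_of_le ht).1 (intervalIntegrable_majorant S c Q ε lam ω t)
  have hpt : ∀ s ∈ Ico 0 t, ‖T (t - s) (B (u s) (u s))‖ ≤ g s := by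
    intro s hs
    have hτ : 0 < t - s := by linarith [hs.2]
    have h1 := hT (t - s) hτ (B (u s) (u s))
    have hfac : 0 ≤ S * (t - s) ^ (-(1 / 2 : ℝ)) * Real.exp (ω * (t - s)) := by
      have := Real.rpow_nonneg hτ.le (-(1 / 2 : ℝ))
      positivity
    have hus : ‖u s‖ ≤ Q * ε * Real.exp (lam * s) := hap s ⟨hs.1, hs.2.le⟩
    have hu0 : 0 ≤ ‖u s‖ := norm_nonneg _
    have h2 : p (B (u s) (u s)) ≤ c * (Q * ε * Real.exp (lam * s)) ^ 2 := by
      calc p (B (u s) (u s)) ≤ c * ‖u s‖ * ‖u s‖ := hB _ _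
        _ = c * (‖u s‖ * ‖u s‖) := by ring
        _ ≤ c * ((Q * ε * Real.exp (lam * s)) * (Q * ε * Real.exp (lam * s))) :=
            mul_le_mul_of_nonneg_left (mul_le_mul hus hus hu0 (hu0.trans hus)) hc
        _ = c * (Q * ε * Real.exp (lam * s)) ^ 2 := by ring
    calc ‖T (t - s) (B (u s) (u s))‖
        ≤ S * (t - s) ^ (-(1 / 2 : ℝ)) * Real.exp (ω * (t - s)) * p (B (u s) (u s)) := h1
      _ ≤ S * (t - s) ^ (-(1 / 2 : ℝ)) * Real.exp (ω * (t - s)) *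
          (c * (Q * ε * Real.exp (lam * s)) ^ 2) := mul_le_mul_of_nonneg_left h2 hfac
  have hae : ∀ᵐ s ∂(volume.restrict (Ioc 0 t)), ‖T (t - s) (B (u s) (u s))‖ ≤ g s := by
    have h1 : ∀ᵐ s ∂(volume.restrict (Ioc 0 t)), s ∈ Ioc 0 t := ae_restrict_mem measurableSet_Ioc
    have h2 : ∀ᵐ s ∂(volume.restrict (Ioc 0 t)), s ∉ ({t} : Set ℝ) := by
      refine ae_restrict_of_ae ?_
      exact measure_eq_zero_iff_ae_notMem.1 (measure_singleton t)
    filter_upwards [h1, h2] with s hs hst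
    have hne : s ≠ t := fun h => hst (by simp [h])
    exact hpt s ⟨hs.1.le, lt_of_le_of_ne hs.2 hne⟩
  -- ‖∫ F‖ ≤ ∫ g ≤ C (Q ε e^{λt})²
  have hnorm : ‖∫ s in Ioc 0 t, T (t - s) (B (u s) (u s))‖ ≤ ∫ s in Ioc 0 t, g s :=
    norm_integral_le_of_norm_le hgi hae
  have hI : ∫ s in Ioc 0 t, g s = ∫ s in (0:ℝ)..t, g s := (integral_of_le ht).symm
  have hD := duhamel_term_le (S := S) (c := c) (Q := Q) (ε := ε) hS hc hgap ht
  rw [hmild, integral_of_le ht]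
  calc ‖∫ s in Ioc 0 t, T (t - s) (B (u s) (u s))‖ ≤ ∫ s in Ioc 0 t, g s := hnorm
    _ = ∫ s in (0:ℝ)..t, g s := hI
    _ ≤ S * c * Real.sqrt (Real.pi / (2 * lam - ω)) * (Q * ε * Real.exp (lam * t)) ^ 2 := hD

/-- **The `hdev` hypothesis of `EmergenceBootstrap.floor_of_bootstrap` from (M)(T)(B).** In the
setting of `norm_sub_le_of_mild`, if the linear prediction has norm `‖ℓ t‖ = ε e^{λt}`, then
`|‖u t‖ − ε e^{λt}| ≤ S·c·√(π/(2λ − ω)) · (Q ε e^{λt})²`. -/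
theorem abs_norm_sub_le_of_mild {p : E → ℝ} {T : ℝ → E → E} {B : E → E → E} {u : ℝ → E} {ℓt : E}
    {S c Q ε lam ω t : ℝ} (hS : 0 ≤ S) (hc : 0 ≤ c) (hgap : ω < 2 * lam) (ht : 0 ≤ t)
    (hT : ∀ τ : ℝ, 0 < τ → ∀ x : E, ‖T τ x‖ ≤ S * τ ^ (-(1 / 2 : ℝ)) * Real.exp (ω * τ) * p x)
    (hB : ∀ x y : E, p (B x y) ≤ c * ‖x‖ * ‖y‖)
    (hmild : u t - ℓt = ∫ s in (0:ℝ)..t, T (t - s) (B (u s) (u s)))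
    (hℓ : ‖ℓt‖ = ε * Real.exp (lam * t))
    (hap : ∀ s ∈ Icc 0 t, ‖u s‖ ≤ Q * ε * Real.exp (lam * s)) :
    |‖u t‖ - ε * Real.exp (lam * t)|
      ≤ S * c * Real.sqrt (Real.pi / (2 * lam - ω)) * (Q * ε * Real.exp (lam * t)) ^ 2 := by
  have h := norm_sub_le_of_mild hS hc hgap ht hT hB hmild hap
  rw [← hℓ]
  exact (abs_norm_sub_norm_le (u t) ℓt).trans h

/-- **R-β ASSEMBLED (INSTAB-BRIDGE §10 l.98 / §13 l.126 (c)), conditional on (M)(T)(B).** Let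
`T, B, p` satisfy (T) and (B) with `S, c ≥ 0` and `2λ > ω`; let `u` be continuous on `[0, T₀]` and
satisfy the mild formula (M) about a linear prediction `ℓ` with `‖ℓ t‖ = ε e^{λt}` (`ε > 0`) at
every `t ∈ [0, T₀]`; let `Q ≥ 1` and put `C = S·c·√(π/(2λ − ω))`. If the window condition
`C Q² ε e^{λt} < Q − 1` holds on `[0, T₀]`, then for every `t ∈ [0, T₀]`:
`ε e^{λt} (1 − C Q² ε e^{λt}) ≤ ‖u t‖ ≤ ε e^{λt} + C (Q ε e^{λt})²`. -/
theorem floor_of_mild {p : E → ℝ} {T : ℝ → E → E} {B : E → E → E} {u ℓ : ℝ → E}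
    {S c Q ε lam ω T₀ : ℝ} (hS : 0 ≤ S) (hc : 0 ≤ c) (hgap : ω < 2 * lam) (hε : 0 < ε) (hQ : 1 ≤ Q)
    (hT : ∀ τ : ℝ, 0 < τ → ∀ x : E, ‖T τ x‖ ≤ S * τ ^ (-(1 / 2 : ℝ)) * Real.exp (ω * τ) * p x)
    (hB : ∀ x y : E, p (B x y) ≤ c * ‖x‖ * ‖y‖)
    (hu : ContinuousOn u (Icc 0 T₀))
    (hmild : ∀ t ∈ Icc 0 T₀, u t - ℓ t = ∫ s in (0:ℝ)..t, T (t - s) (B (u s) (u s)))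
    (hℓ : ∀ t ∈ Icc 0 T₀, ‖ℓ t‖ = ε * Real.exp (lam * t))
    (hsmall : ∀ t ∈ Icc 0 T₀,
      S * c * Real.sqrt (Real.pi / (2 * lam - ω)) * Q ^ 2 * (ε * Real.exp (lam * t)) < Q - 1) :
    ∀ t ∈ Icc 0 T₀,
      ε * Real.exp (lam * t) *
          (1 - S * c * Real.sqrt (Real.pi / (2 * lam - ω)) * Q ^ 2 * (ε * Real.exp (lam * t)))
        ≤ ‖u t‖
      ∧ ‖u t‖ ≤ ε * Real.exp (lam * t) +
          S * c * Real.sqrt (Real.pi / (2 * lam - ω)) * (Q * (ε * Real.exp (lam * t))) ^ 2 := by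
  set C : ℝ := S * c * Real.sqrt (Real.pi / (2 * lam - ω)) with hC
  intro t ht
  have hT₀ : 0 ≤ T₀ := ht.1.trans ht.2
  -- the data of `floor_of_bootstrap` with f = ‖u ·‖, a = ε e^{λ·}
  have hf : ContinuousOn (fun t => ‖u t‖) (Icc 0 T₀) := continuous_norm.comp_continuousOn hu
  have ha : ContinuousOn (fun t => ε * Real.exp (lam * t)) (Icc 0 T₀) :=
    (by fun_prop : Continuous fun t => ε * Real.exp (lam * t)).continuousOn
  have h0 : ‖u 0‖ ≤ Q * (ε * Real.exp (lam * 0)) := by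
    have hm := hmild 0 ⟨le_rfl, hT₀⟩
    rw [intervalIntegral.integral_same, sub_eq_zero] at hm
    rw [hm, hℓ 0 ⟨le_rfl, hT₀⟩]
    have : 0 ≤ ε * Real.exp (lam * 0) := by positivity
    nlinarith
  have hdev : ∀ t ∈ Icc 0 T₀, (∀ s ∈ Icc 0 t, ‖u s‖ ≤ Q * (ε * Real.exp (lam * s))) →
      |‖u t‖ - ε * Real.exp (lam * t)| ≤ C * (Q * (ε * Real.exp (lam * t))) ^ 2 := by
    intro t ht hap
    have hap' : ∀ s ∈ Icc 0 t, ‖u s‖ ≤ Q * ε * Real.exp (lam * s) := fun s hs => by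
      rw [mul_assoc]; exact hap s hs
    have h := abs_norm_sub_le_of_mild hS hc hgap ht.1 hT hB (hmild t ht) (hℓ t ht) hap'
    have e : (Q * ε * Real.exp (lam * t)) ^ 2 = (Q * (ε * Real.exp (lam * t))) ^ 2 := by ring
    rw [hC, ← e]
    exact h
  have hsmall' : ∀ t ∈ Icc 0 T₀, 0 < ε * Real.exp (lam * t) ∧
      C * Q ^ 2 * (ε * Real.exp (lam * t)) < Q - 1 := fun t ht =>
    ⟨by positivity, by rw [hC]; exact hsmall t ht⟩
  have h := floor_of_bootstrap (f := fun t => ‖u t‖) (a := fun t => ε * Real.exp (lam * t))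
    (T := T₀) (Q := Q) (C := C) hf ha h0 hdev hsmall' t ht
  simpa only [hC] using h

/-- **The amplitude floor and the clock (Q = 3/2, χ⋆ = 2/(9C)), conditional on (M)(T)(B).** In
the setting of `floor_of_mild` with `Q = 3/2`: at every `t ∈ [0, T₀]` at which the linear
prediction satisfies `ε e^{λt} ≤ χ⋆ = 2/(9C)`, `C = S·c·√(π/(2λ − ω))`, the true perturbation has
at least half that size, `‖u t‖ ≥ ε e^{λt}/2` — so amplitude `χ⋆/2` is reached no later than the
linear clock `t⋆ = λ⁻¹ log(χ⋆/ε)` whenever `t⋆ ≤ T₀`. -/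
theorem half_prediction_of_mild {p : E → ℝ} {T : ℝ → E → E} {B : E → E → E} {u ℓ : ℝ → E}
    {S c ε lam ω T₀ : ℝ} (hS : 0 ≤ S) (hc : 0 ≤ c) (hgap : ω < 2 * lam) (hε : 0 < ε)
    (hT : ∀ τ : ℝ, 0 < τ → ∀ x : E, ‖T τ x‖ ≤ S * τ ^ (-(1 / 2 : ℝ)) * Real.exp (ω * τ) * p x)
    (hB : ∀ x y : E, p (B x y) ≤ c * ‖x‖ * ‖y‖)
    (hu : ContinuousOn u (Icc 0 T₀))
    (hmild : ∀ t ∈ Icc 0 T₀, u t - ℓ t = ∫ s in (0:ℝ)..t, T (t - s) (B (u s) (u s)))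
    (hℓ : ∀ t ∈ Icc 0 T₀, ‖ℓ t‖ = ε * Real.exp (lam * t))
    (hsmall : ∀ t ∈ Icc 0 T₀, S * c * Real.sqrt (Real.pi / (2 * lam - ω)) * (3 / 2 : ℝ) ^ 2 *
      (ε * Real.exp (lam * t)) < 3 / 2 - 1)
    {t : ℝ} (ht : t ∈ Icc 0 T₀)
    (hχ : ε * Real.exp (lam * t) ≤ 2 / (9 * (S * c * Real.sqrt (Real.pi / (2 * lam - ω))))) :
    ε * Real.exp (lam * t) / 2 ≤ ‖u t‖ := by
  set C : ℝ := S * c * Real.sqrt (Real.pi / (2 * lam - ω)) with hC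
  set a : ℝ := ε * Real.exp (lam * t) with ha
  have h := (floor_of_mild hS hc hgap hε (by norm_num : (1:ℝ) ≤ 3 / 2) hT hB hu hmild hℓ
    hsmall t ht).1
  have ha0 : 0 < a := by positivity
  have hC0 : 0 ≤ C := by positivity
  rcases eq_or_lt_of_le hC0 with hC' | hC'
  · -- degenerate constant: the threshold `2/(9·0) = 0` cannot bound a positive prediction
    exfalso
    rw [← hC'] at hχ
    norm_num at hχ
    exact absurd hχ (not_le.mpr ha0)
  · have hkey : C * (3 / 2 : ℝ) ^ 2 * a ≤ 1 / 2 := by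
      have : C * (3 / 2 : ℝ) ^ 2 * a ≤ C * (3 / 2 : ℝ) ^ 2 * (2 / (9 * C)) :=
        mul_le_mul_of_nonneg_left hχ (by positivity)
      have e : C * (3 / 2 : ℝ) ^ 2 * (2 / (9 * C)) = 1 / 2 := by field_simp; ring
      linarith
    nlinarith

/-! ## Appendix (instab g13, v2): the shape of (T) delivered by the two-level Lyapunov certificate -/

/-- `√(D/τ) = τ^{−1/2}·√D` for `D ≥ 0`, `τ > 0` — the reshaping between the conclusion of
`LyapunovSkewCutSemigroup.norm_le_of_two_level` (`… · √(Re⟪D₁u₀, u₀⟫/t) · e^{ωt}`) and the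
hypothesis (T) of `norm_sub_le_of_mild` (`S · τ^{−1/2} · e^{ωτ} · p x`). -/
theorem sqrt_div_eq_rpow_neg_half_mul {D τ : ℝ} (hD : 0 ≤ D) (hτ : 0 < τ) :
    Real.sqrt (D / τ) = τ ^ (-(1 / 2 : ℝ)) * Real.sqrt D := by
  rw [Real.sqrt_div hD, Real.rpow_neg hτ.le, ← Real.sqrt_eq_rpow τ, div_eq_inv_mul]

omit [NormedSpace ℝ E] in
/-- **(T) from a two-level certificate, literally.** If an evolution family obeys, for every
initial vector `x` and every `τ > 0`, the conclusion of `norm_le_of_two_level` with a nonnegative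
quadratic weight `q x = Re⟪D₁x, x⟫` — `‖T τ x‖ ≤ √(M₁/(c·m₂)) · √(q x/τ) · e^{ωτ}` — then it obeys the
smoothing hypothesis (T) of `norm_sub_le_of_mild` / `floor_of_mild` with `S = √(M₁/(c·m₂))` and the
weak norm `p = √q`: `‖T τ x‖ ≤ S · τ^{−1/2} · e^{ωτ} · √(q x)`. (Getting the two-level conclusion for
EVERY `x`, not only for classical trajectories, is part of the analytic deliverable (M)/(T).) -/
theorem smoothing_bound_of_two_level_shape {T : ℝ → E → E} {q : E → ℝ} {M₁ c m₂ ω : ℝ}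
    (hq : ∀ x : E, 0 ≤ q x)
    (h : ∀ τ : ℝ, 0 < τ → ∀ x : E,
      ‖T τ x‖ ≤ Real.sqrt (M₁ / (c * m₂)) * Real.sqrt (q x / τ) * Real.exp (ω * τ)) :
    ∀ τ : ℝ, 0 < τ → ∀ x : E, ‖T τ x‖ ≤
      Real.sqrt (M₁ / (c * m₂)) * τ ^ (-(1 / 2 : ℝ)) * Real.exp (ω * τ) * Real.sqrt (q x) := by
  intro τ hτ x
  have h1 := h τ hτ x
  rw [sqrt_div_eq_rpow_neg_half_mul (hq x) hτ] at h1
  calc ‖T τ x‖ ≤ Real.sqrt (M₁ / (c * m₂)) * (τ ^ (-(1 / 2 : ℝ)) * Real.sqrt (q x)) *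
        Real.exp (ω * τ) := h1
    _ = Real.sqrt (M₁ / (c * m₂)) * τ ^ (-(1 / 2 : ℝ)) * Real.exp (ω * τ) * Real.sqrt (q x) := by
        ring

/-! ## Appendix (instab g13, v3): density for (T), and the linear clock -/

omit [NormedSpace ℝ E] in
/-- **An inequality between continuous functions extends from a dense set.** -/
theorem le_of_dense {f g : E → ℝ} (hf : Continuous f) (hg : Continuous g) {D : Set E}
    (hD : Dense D) (h : ∀ x ∈ D, f x ≤ g x) : ∀ x : E, f x ≤ g x :=
  fun x => closure_minimal (fun y hy => h y hy) (isClosed_le hf hg) (hD x)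

omit [NormedSpace ℝ E] in
/-- **(T) from a dense set of initial data.** If every `T τ` (`τ > 0`) is continuous (e.g. a bounded
linear operator), the weak norm `p` is continuous, and the smoothing bound
`‖T τ x‖ ≤ S·τ^{−1/2}·e^{ωτ}·p x` holds for all `x` in a DENSE set `D` (the classical initial data the
Lyapunov lemmas treat, via `smoothing_bound_of_two_level_shape`), then it holds for every `x` —
the «density» clause of the analytic deliverable (M)/(T) is this one line. -/
theorem smoothing_bound_of_dense {T : ℝ → E → E} {p : E → ℝ} {S ω : ℝ}
    (hT : ∀ τ : ℝ, 0 < τ → Continuous (T τ)) (hp : Continuous p) {D : Set E} (hD : Dense D)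
    (h : ∀ τ : ℝ, 0 < τ → ∀ x ∈ D, ‖T τ x‖ ≤ S * τ ^ (-(1 / 2 : ℝ)) * Real.exp (ω * τ) * p x) :
    ∀ τ : ℝ, 0 < τ → ∀ x : E, ‖T τ x‖ ≤ S * τ ^ (-(1 / 2 : ℝ)) * Real.exp (ω * τ) * p x :=
  fun τ hτ => le_of_dense (continuous_norm.comp (hT τ hτ)) (continuous_const.mul hp) hD (h τ hτ)

/-- **The linear clock.** For `ε, λ, χ > 0`: the linear prediction `ε e^{λt}` is below the level
`χ` exactly up to `t⋆ = λ⁻¹ log(χ/ε)` — so «wherever `ε e^{λt} ≤ χ⋆`» in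
`half_prediction_of_mild` means «for `t ≤ t⋆`». -/
theorem prediction_le_iff_le_clock {ε lam χ t : ℝ} (hε : 0 < ε) (hlam : 0 < lam) (hχ : 0 < χ) :
    ε * Real.exp (lam * t) ≤ χ ↔ t ≤ Real.log (χ / ε) / lam := by
  have hχε : 0 < χ / ε := div_pos hχ hε
  rw [le_div_iff₀ hlam]
  constructor
  · intro h
    have h1 : Real.exp (lam * t) ≤ χ / ε := by
      rw [le_div_iff₀ hε, mul_comm]; exact h
    have h2 := Real.log_le_log (Real.exp_pos _) h1
    rw [Real.log_exp] at h2
    linarith [mul_comm t lam]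
  · intro h
    have h1 : lam * t ≤ Real.log (χ / ε) := by linarith [mul_comm t lam]
    have h2 : Real.exp (lam * t) ≤ χ / ε := by
      have := Real.exp_le_exp.mpr h1
      rwa [Real.exp_log hχε] at this
    have h3 := mul_le_mul_of_nonneg_left h2 hε.le
    rwa [mul_div_cancel₀ _ hε.ne'] at h3

/-- **At the clock the prediction equals the level:** `ε e^{λ t⋆} = χ` for `t⋆ = λ⁻¹ log(χ/ε)`
(`ε, χ > 0`, `λ ≠ 0`). -/
theorem prediction_at_clock {ε lam χ : ℝ} (hε : 0 < ε) (hlam : lam ≠ 0) (hχ : 0 < χ) :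
    ε * Real.exp (lam * (Real.log (χ / ε) / lam)) = χ := by
  rw [mul_div_cancel₀ _ hlam, Real.exp_log (div_pos hχ hε), mul_div_cancel₀ _ hε.ne']

end Summit.NavierStokesRegularity.FluidComputer.EmergenceMildDuhamel

end
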